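import Mathlib
import HarnessLib
import Summits.QuantumFields.YangMills.Theses.PencilRigidity
import Literature.MathematicalPhysics.QuantumFieldTheory.YangMillsOS
import Literature.MathematicalPhysics.QuantumFieldTheory.LatticeGaugeProofs
import Literature.MathematicalPhysics.QuantumFieldTheory.SpeciesLatticeSupBounds
import Summits.QuantumFields.YangMills.Theorems.InfraredLiouvilleStrongCouplingIRTrivialTwoPoint

/-!
# `CurvatureKernelBound` — stub L1 `LatticeTruncatedTwoPointBound`: the truncated lattice two-point bound

Crux `stmt-QuantumFields-11687` (`PencilRigidity.CurvatureKernelBound`), line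
`sixteen-charts-analytic-kernel`, stub `LatticeTruncatedTwoPointBound` (L1, lattice side).

For a bounded gauge-invariant lattice observable `A` (`|A.F| ≤ B`), a sequential scheme `sch` and
a faithful representation `r`, the truncated (connected) smeared lattice two-point function at
step `k` obeys
`|LS₂(f₀, f₁) − LS₁(f₀) · LS₁(f₁)| ≤ c_k² (2B)² R_k(f₀) R_k(f₁)`, `R_k(f) = a_k⁴ Σ_{x ∈ box} |f(a_k x)|`.

Route: the torus Wilson measure `μ` is a probability measure; with
`A_x(U) = A.F(τ₋ₓ Ũ) − m` the smeared fields are `Φᵢ = c a⁴ Σₓ fᵢ(a x) A_x`, so by linearity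
`LS₂ − LS₁ LS₁ = c² a⁸ Σₓ Σ_y f₀(a x) f₁(a y) Cov_μ(A_x, A_y)` (`latticeSchwinger_two_eq` of the
tree-side support file `StrongCouplingIRTrivial.TwoPoint`, and the one-point analogue
`latticeSchwinger_one_eq` below); and `|Cov_μ(X − p, Y − q)| ≤ (2B)²` whenever `|X|, |Y| ≤ B`
(`abs_cov_sub_const_le`: `Cov = ∫ (X − X̄)(Y − Ȳ)`, `|X − X̄| ≤ 2B`). The triangle inequality over
the double sum finishes. [folklore]
-/

noncomputable section

open scoped SchwartzMap BigOperators
open MeasureTheory Finset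
open Literature.MathematicalPhysics.QuantumFieldTheory Literature.MathematicalPhysics.QuantumLattice
open Literature.Probability.LatticeModels (Site box)
open Summit.QuantumFields.YangMills.Theorems.StrongCouplingIRTrivial.TwoPoint

namespace Summit.QuantumFields.YangMills.Theorems.CurvatureKernel

/-! ## Covariance of bounded random variables under a probability measure -/

/-- `|∫ X dμ| ≤ B` for `|X| ≤ B` under a probability measure. [folklore] -/
theorem abs_integral_le_of_abs_le {Ω : Type*} [MeasurableSpace Ω] {μ : Measure Ω}
    [IsProbabilityMeasure μ] {X : Ω → ℝ} {B : ℝ} (hXb : ∀ ω, |X ω| ≤ B) :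
    |∫ ω, X ω ∂μ| ≤ B := by
  have h := norm_integral_le_of_norm_le_const (μ := μ) (f := X) (C := B)
    (ae_of_all _ fun ω => by rw [Real.norm_eq_abs]; exact hXb ω)
  rwa [probReal_univ, mul_one, Real.norm_eq_abs] at h

/-- Expansion `∫ (X − p)(Y − q) dμ = ∫ X Y dμ − q ∫ X dμ − p ∫ Y dμ + p q` under a probability
measure. [folklore] -/
theorem integral_sub_const_mul_sub_const {Ω : Type*} [MeasurableSpace Ω] (μ : Measure Ω)
    [IsProbabilityMeasure μ] {X Y : Ω → ℝ} (hX : Integrable X μ) (hY : Integrable Y μ)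
    (hXY : Integrable (fun ω => X ω * Y ω) μ) (p q : ℝ) :
    ∫ ω, (X ω - p) * (Y ω - q) ∂μ =
      ∫ ω, X ω * Y ω ∂μ - q * ∫ ω, X ω ∂μ - p * ∫ ω, Y ω ∂μ + p * q := by
  have hexp : (fun ω => (X ω - p) * (Y ω - q)) =
      fun ω => X ω * Y ω - q * X ω - p * Y ω + p * q := by
    funext ω; ring
  have hI1 : Integrable (fun ω => X ω * Y ω - q * X ω) μ := hXY.sub (hX.const_mul q)
  have hI2 : Integrable (fun ω => X ω * Y ω - q * X ω - p * Y ω) μ := hI1.sub (hY.const_mul p)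
  rw [hexp, integral_add hI2 (integrable_const _), integral_sub hI1 (hY.const_mul p),
    integral_sub hXY (hX.const_mul q), integral_const_mul, integral_const_mul, integral_const,
    probReal_univ, one_smul]

/-- **Covariance bound for bounded random variables.** Under a probability measure, if
`|X|, |Y| ≤ B` pointwise then for all constants `p, q`,
`|∫ (X − p)(Y − q) dμ − (∫ (X − p) dμ)(∫ (Y − q) dμ)| ≤ (2B)²`: the left side is
`|∫ (X − X̄)(Y − Ȳ) dμ|` with `X̄ = ∫ X dμ`, and `|X − X̄| ≤ 2B`. [folklore] -/
theorem abs_cov_sub_const_le {Ω : Type*} [MeasurableSpace Ω] (μ : Measure Ω)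
    [IsProbabilityMeasure μ] {X Y : Ω → ℝ} (hX : AEStronglyMeasurable X μ)
    (hY : AEStronglyMeasurable Y μ) {B : ℝ} (hXb : ∀ ω, |X ω| ≤ B) (hYb : ∀ ω, |Y ω| ≤ B)
    (p q : ℝ) :
    |∫ ω, (X ω - p) * (Y ω - q) ∂μ - (∫ ω, (X ω - p) ∂μ) * (∫ ω, (Y ω - q) ∂μ)| ≤
      (2 * B) ^ 2 := by
  have hIX : Integrable X μ :=
    Integrable.of_bound hX B (ae_of_all _ fun ω => by rw [Real.norm_eq_abs]; exact hXb ω)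
  have hIY : Integrable Y μ :=
    Integrable.of_bound hY B (ae_of_all _ fun ω => by rw [Real.norm_eq_abs]; exact hYb ω)
  have hIXY : Integrable (fun ω => X ω * Y ω) μ :=
    hIX.mul_bdd hY (c := B) (ae_of_all _ fun ω => by rw [Real.norm_eq_abs]; exact hYb ω)
  set Xb : ℝ := ∫ ω, X ω ∂μ with hXb_def
  set Yb : ℝ := ∫ ω, Y ω ∂μ with hYb_def
  have h1 : ∫ ω, (X ω - p) ∂μ = Xb - p := by
    rw [integral_sub hIX (integrable_const _), integral_const, probReal_univ, one_smul]
  have h2 : ∫ ω, (Y ω - q) ∂μ = Yb - q := by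
    rw [integral_sub hIY (integrable_const _), integral_const, probReal_univ, one_smul]
  have hkey : ∫ ω, (X ω - p) * (Y ω - q) ∂μ - (∫ ω, (X ω - p) ∂μ) * (∫ ω, (Y ω - q) ∂μ) =
      ∫ ω, (X ω - Xb) * (Y ω - Yb) ∂μ := by
    rw [integral_sub_const_mul_sub_const μ hIX hIY hIXY,
      integral_sub_const_mul_sub_const μ hIX hIY hIXY, h1, h2]
    ring
  rw [hkey]
  have hXb' : |Xb| ≤ B := abs_integral_le_of_abs_le hXb
  have hYb' : |Yb| ≤ B := abs_integral_le_of_abs_le hYb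
  refine abs_integral_le_of_abs_le (μ := μ) fun ω => ?_
  have hB : 0 ≤ B := (abs_nonneg _).trans (hXb ω)
  have e1 : |X ω - Xb| ≤ 2 * B := (abs_sub _ _).trans (by linarith [hXb ω])
  have e2 : |Y ω - Yb| ≤ 2 * B := (abs_sub _ _).trans (by linarith [hYb ω])
  rw [abs_mul]
  calc |X ω - Xb| * |Y ω - Yb| ≤ (2 * B) * (2 * B) :=
        mul_le_mul e1 e2 (abs_nonneg _) (by linarith)
    _ = (2 * B) ^ 2 := by ring

/-! ## The lattice one-point function as a sum -/

section Lattice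

variable {G : Type} [Group G] [TopologicalSpace G] [IsTopologicalGroup G] [CompactSpace G]
  [MeasurableSpace G] [BorelSpace G] {N : ℕ} (ρ : G →* Matrix (Fin N) (Fin N) ℂ)

/-- **The lattice one-point function as a sum.** For `n = 1`,
`latticeSchwinger = c a⁴ ∑ₓ g(a x) ∫ (O(τ₋ₓ Ũ) − m) dμ`. [folklore] -/
theorem latticeSchwinger_one_eq (hρ : Continuous ρ) {ι : Type} (sch : SpeciesScheme ι)
    (obs : ι → LGConfig 4 G → ℝ) (k : ℕ) (σ : Fin 1 → ι)
    (g : Fin 1 → 𝓢(EuclideanSpace ℝ (Fin 4), ℝ))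
    (hmeas : Measurable (obs (σ 0))) (hbdd : ∃ C, ∀ U, |obs (σ 0) U| ≤ C) :
    latticeSchwinger ρ sch obs k 1 σ g =
      sch.c (σ 0) k * sch.a k ^ 4 *
        ∑ x ∈ box 4 (sch.L k), g 0 (sch.a k • siteToE x) *
          ∫ U, (obs (σ 0) (configShift (-x) (torusLift (sch.side k) U)) - sch.m (σ 0) k)
            ∂(wilsonMeasure (d := 4) (L := sch.side k) ρ (sch.β k)) := by
  have hI : ∀ x, Integrable
      (fun U : GaugeConfig 4 (sch.side k) G =>
        obs (σ 0) (configShift (-x) (torusLift (sch.side k) U)) - sch.m (σ 0) k)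
      (wilsonMeasure (d := 4) (L := sch.side k) ρ (sch.β k)) := fun x =>
    integrable_shift_lift ρ hρ _ _ hmeas hbdd x _
  unfold latticeSchwinger
  simp only [Fin.prod_univ_one, smearedLatticeField]
  rw [integral_const_mul, integral_finsetSum _ fun x _ => (hI x).const_mul _]
  congr 1
  refine Finset.sum_congr rfl fun x _ => ?_
  rw [integral_const_mul]

end Lattice

/-! ## The stub -/

/-- **L1 · LatticeTruncatedTwoPointBound.** For a bounded gauge-invariant lattice observable `A`
with `|A.F| ≤ B`, the truncated smeared lattice two-point function at step `k` of the scheme obeys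
`|LS₂(f₀,f₁) − LS₁(f₀) LS₁(f₁)| ≤ c_k² (2B)² (a_k⁴ Σₓ |f₀(a_k x)|) (a_k⁴ Σₓ |f₁(a_k x)|)`
(Wilson's torus measure is a probability measure and `|Cov(X, Y)| ≤ (2B)²` for `|X|, |Y| ≤ B`).
[folklore] -/
theorem LatticeTruncatedTwoPointBound : open Literature.MathematicalPhysics.QuantumLattice Literature.MathematicalPhysics.AQFT Literature.MathematicalPhysics.QuantumFieldTheory in ∀ (G : Type) [Group G] [TopologicalSpace G] [IsTopologicalGroup G] [CompactSpace G] [MeasurableSpace G] [BorelSpace G] (r : LatticeRep G) (sch : SpeciesScheme (YMSpecies G)) (A : YMSpecies G) (B : ℝ), (∀ U : LGConfig 4 G, |A.F U| ≤ B) → ∀ (k : ℕ) (f : Fin 2 → SchwartzMap (EuclideanSpace ℝ (Fin 4)) ℝ), |latticeSchwinger r.ρ sch (fun s => s.F) k 2 (fun _ => A) f - latticeSchwinger r.ρ sch (fun s => s.F) k 1 (fun _ => A) (fun _ => f 0) * latticeSchwinger r.ρ sch (fun s => s.F) k 1 (fun _ => A) (fun _ => f 1)| ≤ (sch.c A k)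 ^ 2 * (2 * B) ^ 2 * ((sch.a k) ^ 4 * ∑ x ∈ Literature.Probability.LatticeModels.box 4 (sch.L k), |f 0 (sch.a k • siteToE x)|) * ((sch.a k) ^ 4 * ∑ x ∈ Literature.Probability.LatticeModels.box 4 (sch.L k), |f 1 (sch.a k • siteToE x)|) := by
  intro G _ _ _ _ _ _ r sch A B hB k f
  -- the torus Wilson state and the shifted, lifted observable
  haveI : IsProbabilityMeasure (wilsonMeasure (d := 4) (L := sch.side k) r.ρ (sch.β k)) :=
    isProbabilityMeasure_wilsonMeasure (d := 4) (L := sch.side k) r.ρ r.continuous (sch.β k)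
  set μ := wilsonMeasure (d := 4) (L := sch.side k) r.ρ (sch.β k) with hμ
  set X : Site 4 → GaugeConfig 4 (sch.side k) G → ℝ :=
    fun x U => A.F (configShift (-x) (torusLift (sch.side k) U)) with hX
  set m : ℝ := sch.m A k with hm
  set c : ℝ := sch.c A k with hc
  set a : ℝ := sch.a k with ha
  set Λ : Finset (Site 4) := box 4 (sch.L k) with hΛ
  have hXmeas : ∀ x, AEStronglyMeasurable (X x) μ := fun x =>
    (A.measurable.comp ((configShift (-x)).measurable.comp
      (measurable_torusLift (sch.side k)))).aestronglyMeasurable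
  have hXb : ∀ x U, |X x U| ≤ B := fun x U => hB _
  -- covariance bound
  have hcov : ∀ x y, |∫ U, (X x U - m) * (X y U - m) ∂μ -
      (∫ U, (X x U - m) ∂μ) * (∫ U, (X y U - m) ∂μ)| ≤ (2 * B) ^ 2 := fun x y =>
    abs_cov_sub_const_le μ (hXmeas x) (hXmeas y) (hXb x) (hXb y) m m
  -- the two-point and one-point functions as sums
  have h2 : latticeSchwinger r.ρ sch (fun s => s.F) k 2 (fun _ => A) f =
      c * c * a ^ 8 * ∑ x ∈ Λ, ∑ y ∈ Λ, f 0 (a • siteToE x) * f 1 (a • siteToE y) *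
        ∫ U, (X x U - m) * (X y U - m) ∂μ := by
    rw [latticeSchwinger_two_eq r.ρ r.continuous sch (fun s => s.F) k (fun _ => A) f
      (fun _ => A.measurable) (fun _ => A.bounded)]
    rfl
  have h1 : ∀ u : 𝓢(EuclideanSpace ℝ (Fin 4), ℝ),
      latticeSchwinger r.ρ sch (fun s => s.F) k 1 (fun _ => A) (fun _ => u) =
        c * a ^ 4 * ∑ x ∈ Λ, u (a • siteToE x) * ∫ U, (X x U - m) ∂μ := by
    intro u
    rw [latticeSchwinger_one_eq r.ρ r.continuous sch (fun s => s.F) k (fun _ => A) (fun _ => u)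
      A.measurable A.bounded]
  -- the truncated function as a double sum
  have hdiff : latticeSchwinger r.ρ sch (fun s => s.F) k 2 (fun _ => A) f -
      latticeSchwinger r.ρ sch (fun s => s.F) k 1 (fun _ => A) (fun _ => f 0) *
        latticeSchwinger r.ρ sch (fun s => s.F) k 1 (fun _ => A) (fun _ => f 1) =
      ∑ x ∈ Λ, ∑ y ∈ Λ, c * c * a ^ 8 * (f 0 (a • siteToE x) * f 1 (a • siteToE y)) *
        (∫ U, (X x U - m) * (X y U - m) ∂μ -
          (∫ U, (X x U - m) ∂μ) * (∫ U, (X y U - m) ∂μ)) := by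
    rw [h2, h1 (f 0), h1 (f 1), mul_sum_mul_mul_sum, Finset.mul_sum, ← Finset.sum_sub_distrib]
    refine Finset.sum_congr rfl fun x _ => ?_
    rw [Finset.mul_sum, ← Finset.sum_sub_distrib]
    refine Finset.sum_congr rfl fun y _ => ?_
    ring
  -- termwise bound
  have hterm : ∀ x y, |c * c * a ^ 8 * (f 0 (a • siteToE x) * f 1 (a • siteToE y)) *
      (∫ U, (X x U - m) * (X y U - m) ∂μ -
        (∫ U, (X x U - m) ∂μ) * (∫ U, (X y U - m) ∂μ))| ≤
      c ^ 2 * (2 * B) ^ 2 *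
        (a ^ 4 * a ^ 4 * (|f 0 (a • siteToE x)| * |f 1 (a • siteToE y)|)) := by
    intro x y
    have ha8 : |a ^ 8| = a ^ 4 * a ^ 4 := by
      rw [abs_of_nonneg (by positivity)]; ring
    rw [abs_mul]
    calc |c * c * a ^ 8 * (f 0 (a • siteToE x) * f 1 (a • siteToE y))| *
          |∫ U, (X x U - m) * (X y U - m) ∂μ -
            (∫ U, (X x U - m) ∂μ) * (∫ U, (X y U - m) ∂μ)|
        ≤ |c * c * a ^ 8 * (f 0 (a • siteToE x) * f 1 (a • siteToE y))| * (2 * B) ^ 2 :=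
          mul_le_mul_of_nonneg_left (hcov x y) (abs_nonneg _)
      _ = c ^ 2 * (2 * B) ^ 2 *
          (a ^ 4 * a ^ 4 * (|f 0 (a • siteToE x)| * |f 1 (a • siteToE y)|)) := by
          simp only [abs_mul, abs_mul_abs_self, ha8]
          ring
  -- sum up
  calc |latticeSchwinger r.ρ sch (fun s => s.F) k 2 (fun _ => A) f -
        latticeSchwinger r.ρ sch (fun s => s.F) k 1 (fun _ => A) (fun _ => f 0) *
          latticeSchwinger r.ρ sch (fun s => s.F) k 1 (fun _ => A) (fun _ => f 1)|
      = |∑ x ∈ Λ, ∑ y ∈ Λ, c * c * a ^ 8 * (f 0 (a • siteToE x) * f 1 (a • siteToE y)) *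
          (∫ U, (X x U - m) * (X y U - m) ∂μ -
            (∫ U, (X x U - m) ∂μ) * (∫ U, (X y U - m) ∂μ))| := by rw [hdiff]
    _ ≤ ∑ x ∈ Λ, |∑ y ∈ Λ, c * c * a ^ 8 * (f 0 (a • siteToE x) * f 1 (a • siteToE y)) *
          (∫ U, (X x U - m) * (X y U - m) ∂μ -
            (∫ U, (X x U - m) ∂μ) * (∫ U, (X y U - m) ∂μ))| :=
        Finset.abs_sum_le_sum_abs _ _
    _ ≤ ∑ x ∈ Λ, ∑ y ∈ Λ, |c * c * a ^ 8 * (f 0 (a • siteToE x) * f 1 (a • siteToE y)) *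
          (∫ U, (X x U - m) * (X y U - m) ∂μ -
            (∫ U, (X x U - m) ∂μ) * (∫ U, (X y U - m) ∂μ))| :=
        Finset.sum_le_sum fun x _ => Finset.abs_sum_le_sum_abs _ _
    _ ≤ ∑ x ∈ Λ, ∑ y ∈ Λ, c ^ 2 * (2 * B) ^ 2 *
          (a ^ 4 * a ^ 4 * (|f 0 (a • siteToE x)| * |f 1 (a • siteToE y)|)) :=
        Finset.sum_le_sum fun x _ => Finset.sum_le_sum fun y _ => hterm x y
    _ = c ^ 2 * (2 * B) ^ 2 * (a ^ 4 * ∑ x ∈ Λ, |f 0 (a • siteToE x)|) *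
          (a ^ 4 * ∑ x ∈ Λ, |f 1 (a • siteToE x)|) := by
        rw [mul_assoc (c ^ 2 * (2 * B) ^ 2), mul_sum_mul_mul_sum, Finset.mul_sum]
        refine Finset.sum_congr rfl fun x _ => ?_
        rw [Finset.mul_sum]

end Summit.QuantumFields.YangMills.Theorems.CurvatureKernel

end
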